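import Literature.NumberTheory.GaloisRepresentations.ArtinCharacterReciprocityProofs
import Literature.NumberTheory.GaloisRepresentations.HeckeCharacterGaloisAvatarProofs
import Literature.NumberTheory.GaloisRepresentations.AbsGaloisOuterConj
import Literature.NumberTheory.GaloisRepresentations.ArtinRestriction
import Literature.NumberTheory.GaloisRepresentations.FrobeniusDensityOneProofs
import Literature.NumberTheory.GaloisRepresentations.WeakAbelianDirectSummandRestrictProofs
import Literature.NumberTheory.GaloisRepresentations.HeckeCharacterDictionary
import Literature.NumberTheory.GaloisRepresentations.ModPGaloisRep
import Literature.NumberTheory.NumberFields.StickelbergerTheorem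
import HarnessLib

/-!
# Mazur 1977, Ch. III §5: Herbrand's theorem with class field theory — the input (R3) of the
# Third reduction, proved

Sibling proof file (theorems only; no definition, no named fact) of
`MazurTorsionThirdReductionProofs` for the prime-case leaf
`Literature.NumberTheory.EllipticCurves.Mazur1977_no_prime_torsion W` (B. Mazur, *Modular curves
and the Eisenstein ideal*, Publ. Math. IHÉS 47 (1977), Ch. III §5, pp. 156–160); it imports only
the Galois-representation / class-field-theory side of the tree (the consequences for the leaf are
drawn in `MazurTorsionLeafFromStepThreeProofs`).

Mazur's **Third reduction** (p. 158) needs, besides Step 4 ("`L/K` is unramified"), exactly one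
arithmetic input: *an everywhere unramified `N`-cyclic extension `L` of `K = ℚ(ζ_N)`, Galois over
`ℚ`, on whose group `Gal(K/ℚ)` acts through `χ⁻¹`, is trivial* — "by Herbrand's theorem
(chap. I (2.9)), … the Bernoulli number `B₂` must have numerator divisible by `N`. Since
`B₂ = 1/6`, `L/K` must be the trivial extension."  In Ch. I §2 (pp. 53–54) Mazur reproves
Herbrand's theorem from "the class field theory isomorphism … [identifying] the Galois group of
the Hilbert class field of `K` … with the ideal class group of `K`", its Galois equivariance
(Cassels–Fröhlich VII (11.5)), and Stickelberger's theorem (Prop. (2.8), Cor. (2.9)).  The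
sibling file `MazurTorsionThirdReductionProofs` isolated this input as the hypothesis (R3) of
`Mazur1977_no_prime_torsion_of_stepThree_of_herbrand` (a Galois-cocycle statement about maps
`b : Γ_ℚ → ℤ/N`).  The tree now PROVES global class field theory for characters
(`Literature.NumberTheory.GaloisRepresentations.artinReciprocity_character_holds`, Tate's Main
Theorem (A) of Cassels–Fröhlich Ch. VII, from the idelic Herbrand-quotient computations),
Stickelberger's theorem for the primes of degree one of `ℚ(ζ_N)` (Kummer 1847;
`Literature.NumberTheory.NumberFields.Stickelberger.isPrincipal_idealPow_quot`, Schoof Thm. 9.5),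
Frobenius' density theorem in the rigidity form "a continuous character of `Γ_E` killing the
Frobenii over a set of places of Dirichlet density one is trivial"
(`MonoidHom.eq_one_of_frobenius_eq_one_of_hasDirichletDensity_one`), and the outer action of `Γ_ℚ`
on `Γ_E` with its transport of primes, inertia and Frobenii (`AbsGaloisOuterConj`,
`ArtinRestriction`).  With these this file proves (R3):

* `Mazur1977_herbrand` (through `Mazur1977_herbrand_aux`, for any model `E` of `ℚ(ζ_N)`) — **(R3)
  for every odd prime `N`**: on `Γ_E`, `E = ℚ(ζ_N)` (`res(Γ_E) = Γ_K`), the character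
  `θ = ζ^{b ∘ res}` is unramified everywhere; by Artin reciprocity it is the Galois avatar of an
  everywhere unramified Hecke character `ω` of finite order, whose ideal character kills the
  principal ideals (`E` is totally complex) and is `χ⁻¹`-equivariant under `Gal(E/ℚ)`; applied to
  Stickelberger's principal ideal `∏_c (σ_c⁻¹ 𝔭)^{⌊2c/N⌋}` at a prime `𝔭` of degree one this gives
  `θ(Frob_𝔭)^{∑_c ⌊2c/N⌋ c} = 1`, and `8 · ∑_c ⌊2c/N⌋ c ≡ 1 (mod N)` (`eight_mul_sum_quot_two_mul`
  — the elementary content of "`N ∤ B₂ = 1/6`") forces `θ(Frob_𝔭) = 1`; the primes of degree one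
  having density one, `θ = 1`, i.e. `b = 0` on `Γ_K`.

Auxiliary results, all proved: `mem_range_absGaloisRestrict_iff_cyclotomicCharacter`
(`res(Γ_{ℚ(ζ_N)}) = ker χ̄_N`), `galEquivZMod_absGaloisQuot` (`Γ_ℚ → Gal(ℚ(ζ_N)/ℚ) ≅ (ℤ/N)ˣ` is
`χ̄_N`), `dvd_absNorm_sub_one` (degree-one primes lie over `ℓ ≡ 1 (mod N)`),
`idealPow_span_singleton_eq_one_of_forall_isUnramifiedAt` (an everywhere unramified finite-order
Hecke character of a totally complex field kills principal ideals; Neukirch VII (6.9), (6.13)),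
`isEmpty_ringHom_real_of_isCyclotomicExtension`, `Stickelberger_quot_two`,
`eight_mul_sum_quot_two_mul`, `exists_rootChar`, `idealPow_finset_prod`.

## References

* B. Mazur, *Modular curves and the Eisenstein ideal*, Publ. Math. IHÉS 47 (1977) 33–186:
  Ch. I §2, Prop. (2.8), Cor. (2.9), pp. 53–54; Ch. III §5, Third reduction, p. 158. [Mazur1977]
* L. C. Washington, *Introduction to Cyclotomic Fields*, 2nd ed., GTM 83 (1997): §6.2
  Thm. 6.10 (Stickelberger), Lemma 6.9; §6.3 Thm. 6.17 (Herbrand); Thm. 2.13. [Washington1997]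
* J. W. S. Cassels, A. Fröhlich (eds.), *Algebraic Number Theory* (1967), Ch. VII (J. Tate),
  §5.1 Main Theorem (A), §11 (11.5). [CasselsFrohlichANT1967]
* R. Schoof, *Catalan's Conjecture*, Universitext (2009), Theorem 9.5. [Schoof2009]
* J. Neukirch, *Algebraic Number Theory* (1999), Ch. VII §6, (6.9), (6.13); §13. [NeukirchANT1999]
-/

noncomputable section

open scoped NumberField Pointwise Polynomial
open Field IsDedekindDomain NumberField

namespace Literature.NumberTheory.EllipticCurves

open Literature.NumberTheory.GaloisRepresentations Literature.NumberTheory.NumberFields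
open Literature.NumberTheory.LFunctions.NumberField


open Literature.NumberTheory.GaloisRepresentations Literature.NumberTheory.NumberFields

section Cyclotomic

variable {N : ℕ} [hN : Fact N.Prime] (E : Type) [Field E] [NumberField E]
  [hE : IsCyclotomicExtension {N} ℚ E]

/-! ### `ℚ(ζ_N)`: the image of `Γ_{ℚ(ζ_N)} → Γ_ℚ` is `Γ_K = ker χ̄_N`, and `Gal(ℚ(ζ_N)/ℚ)` -/

/-- **`res(Γ_E) = ker χ̄_N` for `E = ℚ(ζ_N)`.**  For a cyclotomic field `E` of prime level `N`,
an element of `Γ_ℚ` is the restriction of an element of `Γ_E` (along the tree's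
`absGaloisRestrict ℚ E`, i.e. it fixes the copy `e(E) ⊆ \bar ℚ`,
`mem_range_absGaloisRestrict_iff_smul_absEmbedding`) iff its mod `N` cyclotomic character is
trivial: `e(E) = ℚ(e(ζ_N))` (`IsCyclotomicExtension.adjoin_primitive_root_eq_top`) and
`g • e(ζ_N) = e(ζ_N)^{χ̄(g)}` (`modPCyclotomicCharacterZMod_spec`).  This identifies Mazur's
`Γ_K`, `K = ℚ(ζ_N)` (Mazur 1977, p. 157: "`K = ℚ(μ_N)`"), with the absolute Galois group of the
number field `E`. [cite: Mazur1977, Ch. III §5, p. 157] -/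
theorem mem_range_absGaloisRestrict_iff_cyclotomicCharacter (g : absoluteGaloisGroup ℚ) :
    g ∈ (absGaloisRestrict ℚ E).range ↔ modPCyclotomicCharacterZMod ℚ N g = 1 := by
  have hζ := IsCyclotomicExtension.zeta_spec N ℚ E
  set ζ := IsCyclotomicExtension.zeta N ℚ E with hζdef
  set z : AlgebraicClosure ℚ := absEmbedding ℚ E ζ with hzdef
  have hz : IsPrimitiveRoot z N := hζ.map_of_injective (absEmbedding ℚ E).toRingHom.injective
  have hspec := modPCyclotomicCharacterZMod_spec ℚ N g z hz.pow_eq_one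
  rw [mem_range_absGaloisRestrict_iff_smul_absEmbedding]
  constructor
  · intro h
    have h1 : z ^ ((modPCyclotomicCharacterZMod ℚ N g : ZMod N)).val = z ^ 1 := by
      rw [pow_one, ← hspec]; exact h ζ
    have h2 := hz.pow_inj (ZMod.val_lt _) hN.out.one_lt h1
    ext
    rw [Units.val_one]
    apply ZMod.val_injective N
    rw [h2, ZMod.val_one]
  · intro h x
    have hg1 : g • z = z := by
      rw [hspec, h, Units.val_one, ZMod.val_one, pow_one]
    set φ₁ : E →ₐ[ℚ] AlgebraicClosure ℚ :=
      (absoluteGaloisGroup.toAlgEquiv ℚ g).toAlgHom.comp (absEmbedding ℚ E) with hφ₁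
    have hφ : φ₁ = absEmbedding ℚ E := by
      refine AlgHom.ext_of_adjoin_eq_top
        (IsCyclotomicExtension.adjoin_primitive_root_eq_top (A := ℚ) hζ) fun y hy => ?_
      rw [Set.mem_singleton_iff] at hy
      subst hy
      exact hg1
    exact AlgHom.congr_fun hφ x

/-- `χ̄_N` is trivial on `res(Γ_E)`, `E = ℚ(ζ_N)`. [folklore] -/
theorem cyclotomicCharacter_absGaloisRestrict (σ : absoluteGaloisGroup E) :
    modPCyclotomicCharacterZMod ℚ N (absGaloisRestrict ℚ E σ) = 1 :=
  (mem_range_absGaloisRestrict_iff_cyclotomicCharacter E _).mp ⟨σ, rfl⟩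

/-- **`Γ_ℚ → Gal(ℚ(ζ_N)/ℚ) ≅ (ℤ/N)ˣ` is the mod `N` cyclotomic character**: for `τ ∈ Γ_ℚ`, the
class `a ∈ (ℤ/N)ˣ` with `τ̄(ζ_N) = ζ_N^a` of the image `τ̄ = absGaloisQuot ℚ E τ ∈ Gal(E/ℚ)`
(Mathlib `IsCyclotomicExtension.Rat.galEquivZMod`) is `χ̄_N(τ)` (both are read off from
`e(τ̄ ζ_N) = τ • e(ζ_N)`, `absEmbedding_absGaloisQuot_apply`). [folklore] -/
theorem galEquivZMod_absGaloisQuot (τ : absoluteGaloisGroup ℚ) :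
    haveI := IsCyclotomicExtension.isGalois {N} ℚ E
    IsCyclotomicExtension.Rat.galEquivZMod N E (absGaloisQuot ℚ E τ) =
      modPCyclotomicCharacterZMod ℚ N τ := by
  haveI := IsCyclotomicExtension.isGalois {N} ℚ E
  have hζ := IsCyclotomicExtension.zeta_spec N ℚ E
  set ζ := IsCyclotomicExtension.zeta N ℚ E with hζdef
  set z : AlgebraicClosure ℚ := absEmbedding ℚ E ζ with hzdef
  have hz : IsPrimitiveRoot z N := hζ.map_of_injective (absEmbedding ℚ E).toRingHom.injective
  have hspec := modPCyclotomicCharacterZMod_spec ℚ N τ z hz.pow_eq_one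
  set σ := absGaloisQuot ℚ E τ with hσ
  have h1 : absEmbedding ℚ E (σ ζ) = absEmbedding ℚ E (ζ ^ ((modPCyclotomicCharacterZMod ℚ N τ : ZMod N)).val) := by
    rw [absEmbedding_absGaloisQuot_apply, map_pow, ← hzdef, hspec]
  have h2 := (absEmbedding ℚ E).toRingHom.injective h1
  rw [IsCyclotomicExtension.Rat.galEquivZMod_apply_of_pow_eq N E σ hζ.pow_eq_one] at h2
  have h3 := hζ.pow_inj (ZMod.val_lt _) (ZMod.val_lt _) h2
  ext
  exact ZMod.val_injective N h3

/-- `σ_{χ̄(τ)} = τ̄` in `Gal(ℚ(ζ_N)/ℚ)`, with `σ_a` the tree's `Stickelberger.gal N E a`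
(`σ_a ζ = ζ^a`). [folklore] -/
theorem gal_cyclotomicCharacter_eq_absGaloisQuot (τ : absoluteGaloisGroup ℚ) :
    haveI := IsCyclotomicExtension.isGalois {N} ℚ E
    Stickelberger.gal N E (modPCyclotomicCharacterZMod ℚ N τ) = absGaloisQuot ℚ E τ := by
  haveI := IsCyclotomicExtension.isGalois {N} ℚ E
  rw [Stickelberger.gal, ← galEquivZMod_absGaloisQuot E τ, MulEquiv.symm_apply_apply]

/-- **Primes of degree one of `ℚ(ζ_N)` lie over `ℓ ≡ 1 (mod N)`**: if the absolute norm of a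
prime `𝔭` of `𝓞 E` is a prime `ℓ ≠ N`, then `N ∣ ℓ - 1` (the `N`-th roots of unity inject into
`(𝓞 E/𝔭)ˣ`, of order `ℓ - 1`; Mathlib `Ideal.rootsOfUnityMapQuot_injective`).
Ref: Washington, *Cyclotomic Fields*, Thm. 2.13. [cite: Washington1997, Ch. 2 Thm. 2.13] -/
theorem dvd_absNorm_sub_one {w : HeightOneSpectrum (𝓞 E)}
    (hprime : (Ideal.absNorm w.asIdeal).Prime) (hne : Ideal.absNorm w.asIdeal ≠ N) :
    N ∣ Ideal.absNorm w.asIdeal - 1 := by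
  have hζ := (IsCyclotomicExtension.zeta_spec N ℚ E).toInteger_isPrimitiveRoot
  haveI : w.asIdeal.IsMaximal := w.isPrime.isMaximal w.ne_bot
  letI := Ideal.Quotient.field w.asIdeal
  have hcop : (Ideal.absNorm w.asIdeal).Coprime N := (Nat.coprime_primes hprime hN.out).mpr hne
  have h1 : Ideal.absNorm w.asIdeal ≠ 1 := hprime.ne_one
  have h := Subgroup.card_dvd_of_injective _ (Ideal.rootsOfUnityMapQuot_injective N h1 hcop)
  rw [Nat.card_units] at h
  have hcard : Nat.card (rootsOfUnity N (𝓞 E)) = N := hζ.card_rootsOfUnity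
  have hq : Nat.card (𝓞 E ⧸ w.asIdeal) = Ideal.absNorm w.asIdeal := by
    rw [Ideal.absNorm_apply, Submodule.cardQuot_apply]
  rwa [hcard, hq] at h

end Cyclotomic


open Literature.NumberTheory.GaloisRepresentations Literature.NumberTheory.NumberFields

/-! ### An everywhere unramified Hecke character of finite order of a totally complex field
kills the principal ideals -/

section Principal

variable {K : Type*} [Field K] [NumberField K]

/-- **An everywhere unramified Hecke character of finite order of a totally complex number field
kills the principal ideals.**  For such `χ` and `d ∈ 𝓞 K ∖ {0}`:
`∏_𝔭 χ(ϖ_𝔭)^{ord_𝔭 d} = 1` — Neukirch's decomposition of the principal idele `(d)`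
(`HeckeCharacter.map_principalIdele_eq`: `χ((d)_∞) ∏_{v ∈ S} χ_v(d) = 1`), where `χ((d)_∞) = 1`
because `K` has no real place (`map_infiniteIdeles_eq_one_of_pos`, vacuously) and
`χ_v(d) = χ(ϖ_v)^{ord_v d}` at every (unramified) `v`
(`IsUnramifiedAt.coe_map_localUnits_eq_zpow`).  This is the statement that the ideal character
`𝔞 ↦ ∏ χ(ϖ_𝔭)^{ord_𝔭 𝔞}` (`LFunctions.idealPow`) of an unramified `χ` factors through the ideal
class group (Neukirch VII (6.9), (6.13) with `𝔪 = 1`).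
[cite: NeukirchANT1999, Ch. VII §6 Prop. (6.9), (6.13)] -/
theorem idealPow_span_singleton_eq_one_of_forall_isUnramifiedAt {χ : HeckeCharacter K}
    (hfin : χ.IsFiniteOrder) (hunr : ∀ v, χ.IsUnramifiedAt v) (hreal : IsEmpty (K →+* ℝ))
    {d : 𝓞 K} (hd : d ≠ 0) :
    LFunctions.idealPow K χ.valueAtUniformizer (Ideal.span {d}) = 1 := by
  classical
  obtain ⟨T₀, hT₀, e, hmod₀⟩ := HeckeCharacter.exists_moduleOfDefinition_of_isFiniteOrder hfin
  set T : Finset (HeightOneSpectrum (𝓞 K)) := hT₀.toFinset with hTdef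
  have hmod : HeckeCharacter.IsModulus χ T e := fun x h1 h2 h3 =>
    hmod₀ x h1 h2 fun v hv => h3 v (hT₀.mem_toFinset.mpr hv)
  have hd' : (d : K) ≠ 0 := fun h => hd (by exact_mod_cast h)
  set du : Kˣ := Units.mk0 (d : K) hd' with hdu
  set S : Finset (HeightOneSpectrum (𝓞 K)) :=
    T ∪ (HeckeCharacter.finite_setOf_valuation_coe_ne_one (K := K) hd).toFinset with hSdef
  have hTS : T ⊆ S := Finset.subset_union_left
  have hSd : ∀ v ∉ S, v.valuation K (d : K) = 1 := fun v hv => by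
    by_contra h
    exact hv (Finset.mem_union_right _ ((Set.Finite.mem_toFinset _).mpr h))
  have hB := HeckeCharacter.map_principalIdele_eq hmod du hTS hSd
  have hinf : χ (infiniteIdeles K (globalToInfiniteUnits K du)) = 1 :=
    HeckeCharacter.map_infiniteIdeles_eq_one_of_pos hfin du fun φ => (hreal.false φ).elim
  rw [hinf, one_mul] at hB
  have hval : ∀ v ∈ S, (χ (localUnits v (globalToLocalUnits v du)) : ℂ) =
      χ.valueAtUniformizer v ^ (Associates.mk v.asIdeal).count
        (Associates.mk (Ideal.span {d} : Ideal (𝓞 K))).factors := by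
    intro v _
    rw [(hunr v).coe_map_localUnits_eq_zpow (globalToLocalUnits v du)
      (m := ((Associates.mk v.asIdeal).count (Associates.mk (Ideal.span {d} : Ideal (𝓞 K))).factors : ℤ))
      (by rw [val_globalToLocalUnits, hdu, Units.val_mk0]; exact HeckeCharacter.valued_coe_ringOfIntegers v hd),
      zpow_natCast]
  rw [LFunctions.idealPow, finprod_eq_prod_of_mulSupport_subset _ (s := S) ?_]
  · rw [Finset.prod_congr rfl fun v hv => (hval v hv).symm, ← Units.coe_prod, hB, Units.val_one]
  · intro v hv
    rw [Function.mem_mulSupport] at hv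
    have hcnt : (Associates.mk v.asIdeal).count
        (Associates.mk (Ideal.span {d} : Ideal (𝓞 K))).factors ≠ 0 := fun h0 => hv (by rw [h0, pow_zero])
    have hdvd : v.asIdeal ∣ Ideal.span {d} :=
      (Associates.count_ne_zero_iff_dvd ((Submodule.ne_bot_iff _).mpr
        ⟨d, Ideal.mem_span_singleton_self d, hd⟩) v.irreducible).mp hcnt
    have hdv : d ∈ v.asIdeal := Ideal.dvd_span_singleton.mp hdvd
    rw [Finset.mem_coe]
    by_contra hvS
    have := hSd v hvS
    rw [HeightOneSpectrum.valuation_eq_one_iff_notMem (K := K) v] at this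
    exact this hdv

end Principal

/-! ### The arithmetic of `θ₂`: `8 · ∑_{N/2 < c < N} c ≡ 1 (mod N)` -/

section Theta

variable {N : ℕ} [hN : Fact N.Prime]

/-- The coefficients of the Stickelberger element `θ₂ = ∑_c ⌊2c/N⌋ σ_c⁻¹`: `⌊2c/N⌋ = 1` if
`N ≤ 2c` and `0` otherwise (`0 < c < N`). [cite: Washington1997, §6.2, Lemma 6.9] -/
theorem Stickelberger_quot_two (c : (ZMod N)ˣ) :
    Stickelberger.quot N 2 c = if N ≤ 2 * (c : ZMod N).val then 1 else 0 := by
  unfold Stickelberger.quot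
  have hlt : (c : ZMod N).val < N := ZMod.val_lt _
  split_ifs with h
  · refine Nat.div_eq_of_lt_le (by simpa using h) ?_
    calc 2 * (c : ZMod N).val < 2 * N := by omega
      _ = (1 + 1) * N := by ring
  · exact Nat.div_eq_of_lt (by omega)

/-- **`8 · ∑_c ⌊2c/N⌋ c ≡ 1 (mod N)`** for an odd prime `N`: `∑_{N/2 < c < N} c = (N-1)(3N-1)/8`.
This is the non-vanishing mod `N` of the `ω⁻¹`-component of the Stickelberger generator
`(2 - σ₂) θ`, i.e. of `(2 - ω⁻¹(2)) B_{1,ω} ≡ 3 · B₂/2 = 1/4 · …` — Herbrand's "`N ∤ B₂ = 1/6`"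
(Mazur 1977, Ch. I Cor. (2.9) with `j = -1`; Ch. III §5 p. 158: "Since `B₂ = 1/6`, `L/K` must be
the trivial extension"), in the elementary form used below. [cite: Mazur1977, Ch. I Prop. (2.8), Cor. (2.9), pp. 53–54] -/
theorem eight_mul_sum_quot_two_mul (hN2 : N ≠ 2) :
    (8 : ZMod N) * ∑ c : (ZMod N)ˣ, ((Stickelberger.quot N 2 c : ℕ) : ZMod N) * (c : ZMod N) = 1 := by
  classical
  obtain ⟨h, hNh⟩ := hN.out.odd_of_ne_two hN2
  -- Step 1: sum over units = sum over `ZMod N` of `F x = if N < 2 x.val then x else 0`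
  have hS1 : ∑ c : (ZMod N)ˣ, ((Stickelberger.quot N 2 c : ℕ) : ZMod N) * (c : ZMod N) =
      ∑ x : ZMod N, (if N ≤ 2 * x.val then ((x.val : ℕ) : ZMod N) else 0) := by
    -- a sum over the units of a function vanishing at `0` is the sum over `ZMod N`
    have hF : ∀ (F : ZMod N → ZMod N), F 0 = 0 → ∑ c : (ZMod N)ˣ, F c = ∑ x : ZMod N, F x := by
      intro F hF
      have h1 : ∑ x : ZMod N, F x = ∑ x ∈ (Finset.univ : Finset (ZMod N)).filter (· ≠ 0), F x := by
        rw [Finset.sum_filter_of_ne]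
        intro x _ hx h0
        exact hx (by rw [h0, hF])
      rw [h1]
      exact Finset.sum_bij' (fun c _ => (c : ZMod N)) (fun x hx => Units.mk0 x (Finset.mem_filter.mp hx).2)
        (fun c _ => Finset.mem_filter.mpr ⟨Finset.mem_univ _, c.ne_zero⟩) (fun x _ => Finset.mem_univ _)
        (fun c _ => Units.ext rfl) (fun x _ => rfl) (fun c _ => rfl)
    rw [← hF (fun x : ZMod N => if N ≤ 2 * x.val then ((x.val : ℕ) : ZMod N) else 0) (by simp)]
    refine Finset.sum_congr rfl fun c _ => ?_
    rw [Stickelberger_quot_two]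
    split_ifs
    · rw [Nat.cast_one, one_mul, ZMod.natCast_zmod_val]
    · rw [Nat.cast_zero, zero_mul]
  -- Step 2: reindex by `ℕ`
  have hS2 : ∑ x : ZMod N, (if N ≤ 2 * x.val then ((x.val : ℕ) : ZMod N) else 0) =
      ∑ j ∈ Finset.range N, (if N ≤ 2 * j then ((j : ℕ) : ZMod N) else 0) := by
    obtain ⟨n, hn⟩ : ∃ n, N = n + 1 := ⟨N - 1, (Nat.succ_pred_eq_of_pos hN.out.pos).symm⟩
    subst hn
    exact Fin.sum_univ_eq_sum_range (fun j => if n + 1 ≤ 2 * j then ((j : ℕ) : ZMod (n + 1)) else 0) (n + 1)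
  rw [hS1, hS2, ← Finset.sum_filter]
  -- Step 3: the complementary sum is `∑_{j ≤ h} j`
  have hsplit := Finset.sum_filter_add_sum_filter_not (Finset.range N) (fun j => N ≤ 2 * j)
    (fun j => ((j : ℕ) : ZMod N))
  have hcomp : ∑ j ∈ (Finset.range N).filter (fun j => ¬ N ≤ 2 * j), ((j : ℕ) : ZMod N) =
      ∑ j ∈ Finset.range (h + 1), ((j : ℕ) : ZMod N) := by
    congr 1
    ext j
    simp only [Finset.mem_filter, Finset.mem_range]
    omega
  rw [hcomp] at hsplit
  -- Gauss sums in `ℕ`, cast to `ZMod N`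
  have hg1 : (∑ j ∈ Finset.range N, ((j : ℕ) : ZMod N)) * 2 = 0 := by
    have := congrArg (Nat.cast : ℕ → ZMod N) (Finset.sum_range_id_mul_two N)
    push_cast at this
    rw [this, ZMod.natCast_self, zero_mul]
  have hg2 : (∑ j ∈ Finset.range (h + 1), ((j : ℕ) : ZMod N)) * 2 = ((h : ZMod N) + 1) * h := by
    have := congrArg (Nat.cast : ℕ → ZMod N) (Finset.sum_range_id_mul_two (h + 1))
    push_cast at this
    simpa using this
  have hNz : (2 : ZMod N) * h + 1 = 0 := by
    have : ((2 * h + 1 : ℕ) : ZMod N) = 0 := by rw [← hNh]; exact ZMod.natCast_self N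
    push_cast at this
    exact this
  linear_combination 8 * hsplit + 4 * hg1 - 4 * hg2 - (2 * (h : ZMod N) + 1) * hNz

end Theta

/-! ### Characters of `ℤ/N` with values in `ℂˣ` -/

section RootChar

variable {N : ℕ} [hN : Fact N.Prime]

/-- An injective character `ℤ/N → ℂˣ`, `a ↦ ζ^a` with `ζ = e^{2πi/N}`. [folklore] -/
theorem exists_rootChar :
    ∃ (ζ : ℂˣ) (μ : Multiplicative (ZMod N) →* ℂˣ), IsPrimitiveRoot ζ N ∧ Function.Injective μ ∧
      ∀ a : ZMod N, μ (Multiplicative.ofAdd a) = ζ ^ a.val := by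
  have hN0 : N ≠ 0 := hN.out.ne_zero
  have hz := Complex.isPrimitiveRoot_exp N hN0
  set ζ : ℂˣ := Units.mk0 _ (hz.ne_zero hN0) with hζdef
  have hζ : IsPrimitiveRoot ζ N := IsPrimitiveRoot.coe_units_iff.mp hz
  have hpow : ∀ m : ℕ, ζ ^ (m % N) = ζ ^ m := fun m => by
    rw [hζ.eq_orderOf, pow_mod_orderOf]
  let μ : Multiplicative (ZMod N) →* ℂˣ :=
    { toFun := fun a => ζ ^ (Multiplicative.toAdd a).val
      map_one' := by rw [toAdd_one, ZMod.val_zero, pow_zero]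
      map_mul' := fun a b => by
        rw [toAdd_mul, ZMod.val_add, hpow, pow_add] }
  refine ⟨ζ, μ, hζ, fun a b hab => ?_, fun a => rfl⟩
  have hab' : ζ ^ (Multiplicative.toAdd a).val = ζ ^ (Multiplicative.toAdd b).val := hab
  have := hζ.pow_inj (ZMod.val_lt _) (ZMod.val_lt _) hab'
  exact Multiplicative.toAdd.injective (ZMod.val_injective N this)

end RootChar

/-! ### Cyclotomic fields are totally complex -/

section Real

variable {N : ℕ} [hN : Fact N.Prime] (E : Type) [Field E] [NumberField E]
  [hE : IsCyclotomicExtension {N} ℚ E]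

/-- `ℚ(ζ_N)` is totally complex for `N > 2`: a real `N`-th root of unity is `±1`. [folklore] -/
theorem isEmpty_ringHom_real_of_isCyclotomicExtension (hN2 : N ≠ 2) : IsEmpty (E →+* ℝ) := by
  refine ⟨fun φ => ?_⟩
  have hζ := IsCyclotomicExtension.zeta_spec N ℚ E
  have hr : IsPrimitiveRoot (φ (IsCyclotomicExtension.zeta N ℚ E)) N :=
    hζ.map_of_injective φ.injective
  set r := φ (IsCyclotomicExtension.zeta N ℚ E) with hrdef
  have habs : |r| = 1 := by
    have h1 := congrArg abs hr.pow_eq_one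
    rw [abs_pow, abs_one] at h1
    exact (pow_eq_one_iff_of_nonneg (abs_nonneg r) hN.out.ne_zero).mp h1
  rcases (abs_eq zero_le_one).mp habs with h | h
  · rw [h] at hr
    have h1 := hr.eq_orderOf
    rw [orderOf_one] at h1
    exact hN.out.one_lt.ne' h1
  · have h2 : r ^ 2 = 1 := by rw [h]; norm_num
    have hdvd : N ∣ 2 := hr.dvd_of_pow_eq_one 2 h2
    have := (Nat.prime_dvd_prime_iff_eq hN.out Nat.prime_two).mp hdvd
    exact hN2 this

end Real

/-! ### `idealPow` on products of ideals -/

section IdealPowProd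

variable {K : Type*} [Field K] [NumberField K]

/-- `LFunctions.idealPow` is multiplicative on finite products of nonzero ideals. [folklore] -/
theorem idealPow_finset_prod (f : HeightOneSpectrum (𝓞 K) → ℂ) {ι : Type*} (s : Finset ι)
    (J : ι → Ideal (𝓞 K)) (hJ : ∀ i ∈ s, J i ≠ ⊥) :
    LFunctions.idealPow K f (∏ i ∈ s, J i) = ∏ i ∈ s, LFunctions.idealPow K f (J i) := by
  classical
  induction s using Finset.induction_on with
  | empty => simp [LFunctions.idealPow_top]
  | insert a s ha ih =>
    rw [Finset.prod_insert ha, Finset.prod_insert ha,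
      LFunctions.idealPow_mul f (hJ a (Finset.mem_insert_self a s))
        (Finset.prod_ne_zero_iff.mpr fun i hi => hJ i (Finset.mem_insert_of_mem hi)),
      ih fun i hi => hJ i (Finset.mem_insert_of_mem hi)]

end IdealPowProd

/-! ### Herbrand's theorem at `B₂` with class field theory: the Third reduction's input (R3) -/

section Herbrand

variable {N : ℕ} [hN : Fact N.Prime]

/-- **Mazur's Third reduction input (R3): an everywhere unramified cyclic degree-`N` extension of
`K = ℚ(ζ_N)`, Galois over `ℚ` with `Gal(K/ℚ)` acting on its group by `χ⁻¹`, is trivial**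
(Mazur 1977, Ch. III §5, p. 158: "suppose that `L/K` is unramified, and nontrivial. Then it is an
`N`-cyclic (unramified) extension, and consequently `N` must be an irregular prime. Since `L/ℚ` is
Galois and the natural action of `Gal(K/ℚ)` on `Gal(L/K)` is `χ⁻¹` it would then follow, by
Herbrand's theorem (chap. I (2.9)), that the Bernoulli number `B₂` must have numerator divisible
by `N`. Since `B₂ = 1/6`, `L/K` must be the trivial extension."), in the Galois-cocycle form of
the tree's `Mazur1977_no_prime_torsion_of_stepThree_of_herbrand` (hypothesis `hR3`), for every
odd prime `N`: a map `b : Γ_ℚ → ℤ/N` which is a homomorphism on `Γ_K = ker χ̄_N`, transforms under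
conjugation by `g` through `χ̄(g)⁻¹`, vanishes near `1` on `Γ_K` and on `I_𝔓 ∩ Γ_K` for every prime
`𝔓` of `\bar ℤ`, vanishes on `Γ_K`.

Proof (Mazur, Ch. I §2, pp. 53–54: "we use the class field theory isomorphism to identify the
Galois group of the Hilbert class field of `K` with the ideal class group of `K` … `θ` commutes
with the natural action of `𝔽_pˣ` … [5] VII (11.5); … Stickelberger's theorem; Corollary (2.9)
(Herbrand)"), with the tree's PROVED global class field theory in place of the Hilbert class
field: (1) on `Γ_E`, `E = ℚ(ζ_N)` (`res(Γ_E) = Γ_K`, `mem_range_absGaloisRestrict_iff_cyclotomicCharacter`),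
`θ = ζ^{b ∘ res} : Γ_E → ℂˣ` is a continuous character with open kernel, unramified at every
finite place (inertia restricts into inertia, `exists_primesAbove_restrict`); (2) **Artin
reciprocity** (`artinReciprocity_character_holds`, Cassels–Fröhlich VII §5 Thm. (A)) gives a
Hecke character `ω` of finite order, unramified everywhere, with `ω(ϖ_𝔭) = θ(Frob_𝔭)`; its ideal
character kills principal ideals (`idealPow_span_singleton_eq_one_of_forall_isUnramifiedAt`; `E`
is totally complex); (3) **equivariance** ([5] VII (11.5) in Mazur): `ω(ϖ_{τ̄ 𝔭}) = ω(ϖ_𝔭)^{χ̄(τ)⁻¹}`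
from `b(τ σ τ⁻¹) = χ̄(τ)⁻¹ b(σ)` and the transport of Frobenii along the outer action of `Γ_ℚ` on
`Γ_E` (`isArithFrobAt_absGaloisOuterConj_iff`, `outerConjIdeal_mem_primesAbove`); (4)
**Stickelberger's theorem** at the primes `𝔭` of degree one (Kummer 1847; Schoof Thm. 9.5,
`Stickelberger.isPrincipal_idealPow_quot`): `∏_c (σ_c⁻¹ 𝔭)^{⌊2c/N⌋}` is principal, whence
`θ(Frob_𝔭)^{∑_c ⌊2c/N⌋ c} = 1` and, as `8 ∑_c ⌊2c/N⌋ c ≡ 1 (mod N)` (`eight_mul_sum_quot_two_mul`,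
the incarnation of `N ∤ B₂`), `θ(Frob_𝔭) = 1`; (5) the primes of degree one have Dirichlet density
one, so `θ = 1` (`MonoidHom.eq_one_of_frobenius_eq_one_of_hasDirichletDensity_one`, Frobenius'
density theorem in place of "the classes of degree-one primes generate the class group"), i.e.
`b = 0` on `Γ_K`.  (Herbrand: J. Herbrand, *Sur les classes des corps circulaires*, J. Math. Pures
Appl. 11 (1932); Washington Thm. 6.17.)
[cite: Mazur1977, Ch. III §5, Third reduction, p. 158; Ch. I §2, Prop. (2.8), Cor. (2.9), pp. 53–54]
[cite: Washington1997, §6.3 Thm. 6.17 (Herbrand), §6.2 Thm. 6.10 (Stickelberger)]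
[cite: CasselsFrohlichANT1967, Ch. VII §5.1 Main Theorem (A), §11 (11.5)]
[cite: Schoof2009, Theorem 9.5] -/
theorem Mazur1977_herbrand_aux (E : Type) [Field E] [NumberField E]
    [hE : IsCyclotomicExtension {N} ℚ E] (hN2 : N ≠ 2) (b : absoluteGaloisGroup ℚ → ZMod N)
    (hmul : ∀ σ τ : absoluteGaloisGroup ℚ, modPCyclotomicCharacterZMod ℚ N σ = 1 →
      modPCyclotomicCharacterZMod ℚ N τ = 1 → b (σ * τ) = b σ + b τ)
    (hconj : ∀ g σ : absoluteGaloisGroup ℚ, modPCyclotomicCharacterZMod ℚ N σ = 1 →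
      b (g * σ * g⁻¹) = (((modPCyclotomicCharacterZMod ℚ N g)⁻¹ : (ZMod N)ˣ) : ZMod N) * b σ)
    (hU : ∃ U : Set (absoluteGaloisGroup ℚ), IsOpen U ∧ (1 : absoluteGaloisGroup ℚ) ∈ U ∧
      ∀ σ ∈ U, modPCyclotomicCharacterZMod ℚ N σ = 1 → b σ = 0)
    (hI : ∀ (v : HeightOneSpectrum (𝓞 ℚ)) (𝔓 : Ideal (absIntegers (𝓞 ℚ) ℚ)), 𝔓 ∈ v.primesAbove →
      ∀ τ ∈ 𝔓.inertia (absoluteGaloisGroup ℚ), modPCyclotomicCharacterZMod ℚ N τ = 1 → b τ = 0) :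
    ∀ σ : absoluteGaloisGroup ℚ, modPCyclotomicCharacterZMod ℚ N σ = 1 → b σ = 0 := by
  classical
  -- (0) `res : Γ_E → Γ_ℚ` has image `Γ_K = ker χ̄`
  haveI : IsGalois ℚ E := IsCyclotomicExtension.isGalois {N} ℚ E
  have hres1 : ∀ σ : absoluteGaloisGroup E,
      modPCyclotomicCharacterZMod ℚ N (absGaloisRestrict ℚ E σ) = 1 :=
    cyclotomicCharacter_absGaloisRestrict E
  -- (1) the character `θ = ζ^{b ∘ res} : Γ_E → ℂˣ`
  obtain ⟨-, μ, -, hμinj, -⟩ := exists_rootChar (N := N)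
  have hψmul : ∀ σ τ : absoluteGaloisGroup E, b (absGaloisRestrict ℚ E (σ * τ)) =
      b (absGaloisRestrict ℚ E σ) + b (absGaloisRestrict ℚ E τ) := fun σ τ => by
    rw [map_mul]; exact hmul _ _ (hres1 σ) (hres1 τ)
  have hψone : b (absGaloisRestrict ℚ E 1) = 0 := by
    have h := hψmul 1 1
    rwa [mul_one, left_eq_add] at h
  let θ : absoluteGaloisGroup E →* ℂˣ :=
    { toFun := fun σ => μ (Multiplicative.ofAdd (b (absGaloisRestrict ℚ E σ)))
      map_one' := by
        show μ (Multiplicative.ofAdd (b (absGaloisRestrict ℚ E 1))) = 1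
        rw [hψone, ofAdd_zero, map_one]
      map_mul' := fun σ τ => by
        show μ (Multiplicative.ofAdd (b (absGaloisRestrict ℚ E (σ * τ)))) =
          μ (Multiplicative.ofAdd (b (absGaloisRestrict ℚ E σ))) *
            μ (Multiplicative.ofAdd (b (absGaloisRestrict ℚ E τ)))
        rw [hψmul, ofAdd_add, map_mul] }
  have hθ : ∀ σ, θ σ = μ (Multiplicative.ofAdd (b (absGaloisRestrict ℚ E σ))) := fun _ => rfl
  have hθ1 : ∀ σ, θ σ = 1 ↔ b (absGaloisRestrict ℚ E σ) = 0 := fun σ => by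
    rw [hθ, ← map_one μ, ← ofAdd_zero, hμinj.eq_iff]
    exact Multiplicative.ofAdd.injective.eq_iff
  -- (2) `ker θ` is open, so `θ` is continuous: a rank-one Artin representation `ρ` of `E`
  have hker : IsOpen (θ.ker : Set (absoluteGaloisGroup E)) := by
    obtain ⟨U, hUo, hU1, hUb⟩ := hU
    apply Subgroup.isOpen_of_mem_nhds (g := 1)
    have hc : Continuous fun σ : absoluteGaloisGroup E => absGaloisRestrict ℚ E σ :=
      continuous_absGaloisRestrictMonoidHom ℚ E
    have hpre : (fun σ : absoluteGaloisGroup E => absGaloisRestrict ℚ E σ) ⁻¹' U ∈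
        nhds (1 : absoluteGaloisGroup E) :=
      (hUo.preimage hc).mem_nhds (show absGaloisRestrict ℚ E 1 ∈ U by rw [map_one]; exact hU1)
    filter_upwards [hpre] with σ hσ
    rw [SetLike.mem_coe, MonoidHom.mem_ker]
    exact (hθ1 σ).mpr (hUb _ hσ (hres1 σ))
  have hθcont : Continuous θ := MonoidHom.continuous_of_isOpen_ker θ hker
  set ρ : FramedArtinRep E 1 := FramedGaloisRep.ofOpenKer θ hker with hρ
  -- (3) `ρ` is unramified at every finite place of `E` (inertia restricts into inertia)
  have hunrρ : ∀ w : HeightOneSpectrum (𝓞 E), ρ.IsUnramifiedAt w := by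
    intro w
    rw [hρ, FramedGaloisRep.isUnramifiedAt_ofOpenKer_iff]
    intro 𝔔 h𝔔 σ hσ
    obtain ⟨𝔓, h𝔓, hIres, -⟩ :=
      exists_primesAbove_restrict ℚ E (v := w.under (𝓞 ℚ)) (w := w) rfl h𝔔
    exact (hθ1 σ).mpr (hI _ 𝔓 h𝔓 _ (hIres σ hσ) (hres1 σ))
  -- (4) Artin reciprocity: the Hecke character `ω` of `θ`, unramified everywhere, `ω(ϖ_w) = θ(Frob_w)`
  obtain ⟨ω, hωfin, hω⟩ := artinReciprocity_character_holds E ρ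
  have hωunr : ∀ w, ω.IsUnramifiedAt w := fun w => (hω w (hunrρ w)).1
  have hωfrob : ∀ (w : HeightOneSpectrum (𝓞 E)), ∀ 𝔔 ∈ w.primesAbove,
      ∀ Φ : absoluteGaloisGroup E, IsArithFrobAt (𝓞 E) Φ 𝔔 →
        ((θ Φ : ℂˣ) : ℂ) = ω.valueAtUniformizer w := fun w =>
    (FramedGaloisRep.hasFrobCharpolyAt_ofOpenKer_iff θ hker w _).mp (hω w (hunrρ w)).2
  -- (5) the ideal character `𝔞 ↦ ∏_w ω(ϖ_w)^{ord_w 𝔞}` kills principal ideals (`E` is totally complex)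
  have hG1 : ∀ d : 𝓞 E, d ≠ 0 → LFunctions.idealPow E ω.valueAtUniformizer (Ideal.span {d}) = 1 :=
    fun d hd => idealPow_span_singleton_eq_one_of_forall_isUnramifiedAt hωfin hωunr
      (isEmpty_ringHom_real_of_isCyclotomicExtension E hN2) hd
  -- (6) equivariance: `ω(ϖ_{τ̄ • w}) = ζ^{χ̄(τ)⁻¹ m_w}` with `ζ^{m_w} = θ(Frob_w)`
  have hm : ∀ w : HeightOneSpectrum (𝓞 E), ∃ m : ZMod N, ∀ τ : absoluteGaloisGroup ℚ,
      ω.valueAtUniformizer (absGaloisQuot ℚ E τ • w) =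
        ((μ (Multiplicative.ofAdd ((((modPCyclotomicCharacterZMod ℚ N τ)⁻¹ : (ZMod N)ˣ) : ZMod N) * m))
          : ℂˣ) : ℂ) := by
    intro w
    obtain ⟨𝔔, h𝔔⟩ := w.primesAbove_nonempty
    obtain ⟨Φ, hΦ⟩ := HeightOneSpectrum.exists_isArithFrobAt_of_mem_primesAbove_holds h𝔔
    refine ⟨b (absGaloisRestrict ℚ E Φ), fun τ => ?_⟩
    have h𝔔' := outerConjIdeal_mem_primesAbove h𝔔 τ
    have hΦ' := (isArithFrobAt_absGaloisOuterConj_iff h𝔔 τ Φ).mpr hΦ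
    rw [← hωfrob _ _ h𝔔' _ hΦ', hθ, absGaloisRestrict_absGaloisOuterConj, hconj τ _ (hres1 Φ)]
  -- (7) Stickelberger's theorem at the primes of degree one: their Frobenii lie in `ker θ`
  have hkill : ∀ w : HeightOneSpectrum (𝓞 E), (Ideal.absNorm w.asIdeal).Prime →
      Ideal.absNorm w.asIdeal ≠ N → ∀ 𝔔 ∈ w.primesAbove, ∀ Φ : absoluteGaloisGroup E,
        IsArithFrobAt (𝓞 E) Φ 𝔔 → θ Φ = 1 := by
    intro w hprime hne 𝔔 h𝔔 Φ hΦ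
    obtain ⟨m, hmw⟩ := hm w
    -- `ω(ϖ_{σ_c⁻¹ w}) = ζ^{c m}`
    have hfc : ∀ c : (ZMod N)ˣ, ω.valueAtUniformizer ((Stickelberger.gal N E c)⁻¹ • w) =
        μ (Multiplicative.ofAdd ((c : ZMod N) * m)) := by
      intro c
      obtain ⟨τ, hτ⟩ := absGaloisQuot_surjective ℚ E (Stickelberger.gal N E c)⁻¹
      have hχτ : modPCyclotomicCharacterZMod ℚ N τ = c⁻¹ := by
        apply Stickelberger.gal_injective (p := N) (K := E)
        rw [gal_cyclotomicCharacter_eq_absGaloisQuot E τ, hτ, Stickelberger.gal_inv]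
      rw [← hτ, hmw τ, hχτ, inv_inv]
    have hfw : ω.valueAtUniformizer w = μ (Multiplicative.ofAdd m) := by
      have h := hmw 1
      simp only [map_one, one_smul, inv_one, Units.val_one, one_mul] at h
      exact h
    -- `θ(Frob_w) = ζ^m`
    have hθΦ : θ Φ = μ (Multiplicative.ofAdd m) :=
      Units.ext ((hωfrob w 𝔔 h𝔔 Φ hΦ).trans hfw)
    -- Stickelberger: `∏_c (σ_c⁻¹ 𝔭_w)^{⌊2c/N⌋} = (d)`
    haveI : Fact (Ideal.absNorm w.asIdeal).Prime := ⟨hprime⟩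
    haveI := w.isPrime
    have hℓw : ((Ideal.absNorm w.asIdeal : ℕ) : 𝓞 E) ∈ w.asIdeal := Ideal.absNorm_mem w.asIdeal
    obtain ⟨⟨d, hd⟩⟩ := Stickelberger.isPrincipal_idealPow_quot (K := E) hN2
      (dvd_absNorm_sub_one E hprime hne) w.asIdeal hℓw 2
    have hd' : Stickelberger.idealPow (Stickelberger.quot N 2) w.asIdeal = Ideal.span {d} := hd
    have hne_bot : Stickelberger.idealPow (Stickelberger.quot N 2) w.asIdeal ≠ ⊥ :=
      Stickelberger.idealPow_ne_bot _ w.ne_bot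
    have hd0 : d ≠ 0 := by
      rintro rfl
      rw [hd', Ideal.span_singleton_eq_bot.mpr rfl] at hne_bot
      exact hne_bot rfl
    -- apply the ideal character: `ζ^{(∑_c ⌊2c/N⌋ c) m} = 1`
    have hsm : ∀ c : (ZMod N)ˣ, (Stickelberger.gal N E c)⁻¹ • w.asIdeal ≠ ⊥ := fun c =>
      (Literature.NumberTheory.Automorphic.Ideal.smul_eq_bot_iff _ _).not.mpr w.ne_bot
    have hprod : LFunctions.idealPow E ω.valueAtUniformizer
        (Stickelberger.idealPow (Stickelberger.quot N 2) w.asIdeal) =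
        ((μ (Multiplicative.ofAdd ((∑ c : (ZMod N)ˣ,
          ((Stickelberger.quot N 2 c : ℕ) : ZMod N) * (c : ZMod N)) * m)) : ℂˣ) : ℂ) := by
      rw [Stickelberger.idealPow, idealPow_finset_prod ω.valueAtUniformizer Finset.univ
        (fun c => ((Stickelberger.gal N E c)⁻¹ • w.asIdeal) ^ Stickelberger.quot N 2 c)
        (fun c _ => pow_ne_zero _ (hsm c)),
        Finset.sum_mul, ofAdd_sum, map_prod, Units.coe_prod]
      refine Finset.prod_congr rfl fun c _ => ?_
      rw [LFunctions.idealPow_pow _ (hsm c), ← Literature.NumberTheory.Automorphic.HeightOneSpectrum.smul_asIdeal,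
        LFunctions.idealPow_asIdeal, hfc c, ← Units.val_pow_eq_pow_val, ← map_pow, ← ofAdd_nsmul,
        nsmul_eq_mul, mul_assoc]
    rw [hd', hG1 d hd0] at hprod
    have hsum : (∑ c : (ZMod N)ˣ,
        ((Stickelberger.quot N 2 c : ℕ) : ZMod N) * (c : ZMod N)) * m = 0 := by
      have h1 : μ (Multiplicative.ofAdd ((∑ c : (ZMod N)ˣ,
          ((Stickelberger.quot N 2 c : ℕ) : ZMod N) * (c : ZMod N)) * m)) = 1 :=
        Units.val_eq_one.mp hprod.symm
      rw [← map_one μ, ← ofAdd_zero] at h1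
      exact Multiplicative.ofAdd.injective (hμinj h1)
    have hm0 : m = 0 := by
      calc m = ((8 : ZMod N) * ∑ c : (ZMod N)ˣ,
            ((Stickelberger.quot N 2 c : ℕ) : ZMod N) * (c : ZMod N)) * m := by
              rw [eight_mul_sum_quot_two_mul hN2, one_mul]
        _ = 0 := by rw [mul_assoc, hsum, mul_zero]
    rw [hθΦ, hm0, ofAdd_zero, map_one]
  -- (8) the primes of degree one prime to `N` have Dirichlet density one, so `θ = 1`
  set 𝓛 : Set (HeightOneSpectrum (𝓞 E)) :=
    {w | (Ideal.absNorm w.asIdeal).Prime ∧ Ideal.absNorm w.asIdeal ≠ N} with h𝓛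
  have hdens : HasDirichletDensity E 𝓛 1 := by
    set Z : Set (HeightOneSpectrum (𝓞 ℚ)) := {v | ((N : ℕ) : 𝓞 ℚ) ∈ v.asIdeal} with hZ
    have hZfin : Z.Finite := by
      have hNb : (Ideal.span {((N : ℕ) : 𝓞 ℚ)} : Ideal (𝓞 ℚ)) ≠ ⊥ := by
        rw [Ne, Ideal.span_singleton_eq_bot]
        exact_mod_cast hN.out.ne_zero
      exact (Ideal.finite_factors hNb).subset fun v hv => Ideal.dvd_span_singleton.mpr hv
    have hZ0 : HasDirichletDensity ℚ Z 0 := hasDirichletDensity_zero_of_finite hZfin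
    have hX0 : HasDirichletDensity E 𝓛ᶜ 0 := by
      refine hasDirichletDensity_zero_of_forall_under_mem (M := E) (F := ℚ) (X := 𝓛ᶜ) (Z := Z)
        (fun w hw hp => ?_) hZ0
      have hwN : Ideal.absNorm w.asIdeal = N := by
        by_contra h
        exact hw ⟨hp, h⟩
      show ((N : ℕ) : 𝓞 ℚ) ∈ (w.under (𝓞 ℚ)).asIdeal
      rw [HeightOneSpectrum.under_asIdeal, Ideal.under_def, Ideal.mem_comap, map_natCast]
      have hmem := Ideal.absNorm_mem w.asIdeal
      rwa [hwN] at hmem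
    have h1 := hX0.compl
    rwa [compl_compl, sub_zero] at h1
  have hθtriv : θ = 1 :=
    MonoidHom.eq_one_of_frobenius_eq_one_of_hasDirichletDensity_one θ hθcont hdens
      fun w hw 𝔔 h𝔔 Φ hΦ => hkill w hw.1 hw.2 𝔔 h𝔔 Φ hΦ
  -- (9) conclusion: `b ∘ res = 0` and `res(Γ_E) = Γ_K`
  intro σ hσ
  obtain ⟨σ', rfl⟩ := (mem_range_absGaloisRestrict_iff_cyclotomicCharacter E σ).mpr hσ
  exact (hθ1 σ').mp (by rw [hθtriv, MonoidHom.one_apply])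

/-- **(R3) for every odd prime `N`** — `Mazur1977_herbrand_aux` at the cyclotomic field
`CyclotomicField N ℚ`: the hypothesis `hR3` of `Mazur1977_no_prime_torsion_of_stepThree_of_herbrand`
(see `Mazur1977_herbrand_aux` for the statement and the proof).
[cite: Mazur1977, Ch. III §5, Third reduction, p. 158; Ch. I §2, Cor. (2.9)] -/
theorem Mazur1977_herbrand (hN2 : N ≠ 2) (b : absoluteGaloisGroup ℚ → ZMod N)
    (hmul : ∀ σ τ : absoluteGaloisGroup ℚ, modPCyclotomicCharacterZMod ℚ N σ = 1 →
      modPCyclotomicCharacterZMod ℚ N τ = 1 → b (σ * τ) = b σ + b τ)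
    (hconj : ∀ g σ : absoluteGaloisGroup ℚ, modPCyclotomicCharacterZMod ℚ N σ = 1 →
      b (g * σ * g⁻¹) = (((modPCyclotomicCharacterZMod ℚ N g)⁻¹ : (ZMod N)ˣ) : ZMod N) * b σ)
    (hU : ∃ U : Set (absoluteGaloisGroup ℚ), IsOpen U ∧ (1 : absoluteGaloisGroup ℚ) ∈ U ∧
      ∀ σ ∈ U, modPCyclotomicCharacterZMod ℚ N σ = 1 → b σ = 0)
    (hI : ∀ (v : HeightOneSpectrum (𝓞 ℚ)) (𝔓 : Ideal (absIntegers (𝓞 ℚ) ℚ)), 𝔓 ∈ v.primesAbove →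
      ∀ τ ∈ 𝔓.inertia (absoluteGaloisGroup ℚ), modPCyclotomicCharacterZMod ℚ N τ = 1 → b τ = 0) :
    ∀ σ : absoluteGaloisGroup ℚ, modPCyclotomicCharacterZMod ℚ N σ = 1 → b σ = 0 := by
  -- Mathlib states `IsCyclotomicExtension {N} ℚ (CyclotomicField N ℚ)` for the splitting-field
  -- `ℚ`-algebra structure; transport it to `DivisionRing.toRatAlgebra` (`Algebra ℚ _` is a subsingleton)
  haveI : IsCyclotomicExtension {N} ℚ (CyclotomicField N ℚ) := by
    convert CyclotomicField.instIsCyclotomicExtensionSingletonNatSetOfCharZero N ℚ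
    · rfl
    · exact Subsingleton.elim _ _
  exact Mazur1977_herbrand_aux (CyclotomicField N ℚ) hN2 b hmul hconj hU hI

end Herbrand

end Literature.NumberTheory.EllipticCurves

end
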